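import Summits.CriticalPhenomena.PercolationContinuityZ3.Theorems.PercNearOneGluingNoHeavyLowerTailSahiHubCorner
import Summits.CriticalPhenomena.PercolationContinuityZ3.Theorems.PercNearOneGluingNoHeavyLowerTailSahiHubTwoLevelI3
import Literature.Combinatorics.Sahi2008.TotalOrder
import Mathlib.Tactic.Linarith
import Mathlib.Tactic.Ring
import Mathlib.Tactic.Positivity
import Mathlib.Tactic.FinCases
import HarnessLib

/-!
# `NoHeavyLowerTail` (crux stmt-CriticalPhenomena-4575), P2 — **T₁ WITH A TOTALLY ORDERED CO-SHARED BLOCK: KAHN'S `C₃` FOR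
# `f(z,c,a), g(z,c,b), h(z,a,b)` WITH `c` IN ANY FINITE CHAIN** (the pair decomposition of the hub-corner form)

Seat `prim-masterthm-p2`, gen 31 (memo `FROM-prim-masterthm-p2-g31-PAIR-DECOMPOSITION.md`, SAHI-ROUTE.md §4.58;
`--supports stmt-CriticalPhenomena-4575`).  No `sorry`, no named facts, standard axioms.
SETTING as in `…SahiHubCorner` (gen 30): hub coin `z ∈ Fin 2`, co-shared block `γ` of the first two members (probability weight `wC`),
private FKG blocks `α, β`; the triple `f(z,c,a), g(z,c,b), h(z,a,b)`; hub-corner forms `cornerQ0, cornerQ1` (`q₀, q₁`); and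
`SahiHubCorner.sahiE_three_nonneg_T1_of_corner`: `q₀ ≥ 0 ∧ q₁ ≥ 0 ⟹ E₃ ≥ 0`.
* **PAIR DECOMPOSITION** (`two_mul_cornerQ1_eq_sum_pairForm`; bookkeeping, ANY finite `γ`, weights of mass one):
  `2·q₁ = Σ_x Σ_y wC(x)·wC(y)·CF(x,y)`, the PAIR FORM `CF(x,y) = pairForm x y` being — by definition — the bias-free cross form
  `SahiHubTwoLevel.crossForm` ("I3", gens 28–29) of the two-point section families at `x, y` (`fpair`, `gpair`); `CF(x,y) = A(x,y)+A(y,x)`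
  for the explicit point kernel `pairKer` (`pairForm_eq_pairKer`), `CF` is symmetric (`pairForm_symm`), `CF(x,x)/2` is the corner form of the
  `x`-section triple.  (On a CUBE block `CF` over an edge is the mixed tensor-Bernstein coefficient of `q₁`; higher mixed coefficients are box
  sums of `CF` — conjecture FCQ of the memo, census-clean (kit j245242), open.)
* **`pairForm_nonneg_of_le`**: for COMPARABLE points `x ≤ y` (sections monotone in `c`) `CF(x,y) ≥ 0` — literally `SahiHubTwoLevel.crossForm_nonneg`
  (gen 29), whose nesting hypotheses `f 0 z ≤ f 1 z` are the order of the two points.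
* Hence `cornerQ1_nonneg_of_pairForm` (any block: `q₁ ≥ 0` once every pair form is `≥ 0` — only INCOMPARABLE pairs can fail),
  `cornerQ1_nonneg_chain`, `cornerQ0_eq` (`q₀ = q₁ + Δf·Δg·Δh`), `cornerQ0_nonneg_chain`: **Q HOLDS ON EVERY TOTALLY ORDERED BLOCK WITH ANY
  PROBABILITY WEIGHT**, and **`sahiE_three_nonneg_T1_chain`: SAHI'S `E₃ ≥ 0` / KAHN'S `C₃` FOR EVERY TRIPLE `f(z,c,a), g(z,c,b), h(z,a,b)`** —
  hub coin with any bias, `c` in a finite CHAIN with any probability weight, `α, β` FKG lattices, sections nonnegative and monotone in every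
  argument.  Extends T₁(|C|=1) (`…SahiHubTwoLevelI3`: the two-point chain) to chains of any length.
HONEST LABEL: T₁ with a chain co-shared block PROVED; T₁ with a cube co-shared block of ≥ 2 coins and Kahn's `C₃` OPEN. [this work]
-/

noncomputable section

open scoped Classical

namespace Summit.CriticalPhenomena.PercolationContinuityZ3.Theorems

namespace SahiHubCornerChain

open Finset Literature.Combinatorics.Sahi2008 SahiHubCorner SahiHubTwoLevel

section Defs

variable {α β γ : Type} [Fintype α] [Fintype β] [Fintype γ]
  (wA : α → ℝ) (wB : β → ℝ) (wC : γ → ℝ)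
  (f : Fin 2 → γ → α → ℝ) (g : Fin 2 → γ → β → ℝ) (h : Fin 2 → α → β → ℝ)

/-- The TWO-POINT SECTION FAMILY of `f` at the block points `x` (index `0`) and `y` (index `1`), in the format of
`…SahiHubTwoLevel` (`i` = point index, `z` = hub level): `fpair f x y i z a = f z (![x,y] i) a`. [this work] -/
def fpair (x y : γ) : Fin 2 → Fin 2 → α → ℝ := fun i z a => f z (![x, y] i) a

/-- The two-point section family of `g`: `gpair g x y j z b = g z (![x,y] j) b`. [this work] -/
def gpair (x y : γ) : Fin 2 → Fin 2 → β → ℝ := fun j z b => g z (![x, y] j) b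

/-- **THE PAIR FORM** `CF(x,y)`: the bias-free cross form `crossForm` ("I3", gen 28/29) of the two-point families at `x, y`. [this work] -/
def pairForm (x y : γ) : ℝ := crossForm wA wB (fpair f x y) (gpair g x y) h

/-- Point atom `F_z(c) = E_a f_z(c,·)`. [this work] -/
def Fp (z : Fin 2) (c : γ) : ℝ := ∑ a, wA a * f z c a
/-- Point atom `G_z(c) = E_b g_z(c,·)`. [this work] -/
def Gp (z : Fin 2) (c : γ) : ℝ := ∑ b, wB b * g z c b
/-- Point atom `Ȳ_z(c) = E_{ab}[f_z(c,a) h_z(a,b)]`. [this work] -/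
def Yp (z : Fin 2) (c : γ) : ℝ := ∑ b, wB b * ∑ a, wA a * (f z c a * h z a b)
/-- Point atom `J_z(c) = E_{ab}[f_z(c,a) g_z(c,b) h_z(a,b)]` (joint moment at the block point `c`). [this work] -/
def Jp (z : Fin 2) (c : γ) : ℝ := ∑ b, wB b * (g z c b * ∑ a, wA a * (f z c a * h z a b))
/-- Point atom `K_z(c) = E_{ab}[g_z(c,b) h_z(a,b)]`. [this work] -/
def Kp (z : Fin 2) (c : γ) : ℝ := ∑ b, wB b * (g z c b * ∑ a, wA a * h z a b)

/-- The (asymmetric) POINT KERNEL `A(x,y)` of the pair decomposition: joint moments at `x`, first-member means at `y`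
(`H̄_z = Hb`):  `A(x,y) = 2J₁(x) + 2J₀(x) − H̄₀F₁(x)G₁(x) − H̄₁F₀(x)G₀(x) − F₀(y)K₁(x) − F₁(y)K₀(x) − G₀(x)Ȳ₁(y) − G₁(x)Ȳ₀(y)
 − F₁(y)G₁(x)H̄₁ + F₀(y)G₁(x)H̄₁ + F₁(y)G₀(x)H̄₁ + F₁(y)G₁(x)H̄₀`. [this work] -/
def pairKer (x y : γ) : ℝ :=
  2 * Jp wA wB f g h 1 x + 2 * Jp wA wB f g h 0 x
    - Hb wA wB h 0 * (Fp wA f 1 x * Gp wB g 1 x) - Hb wA wB h 1 * (Fp wA f 0 x * Gp wB g 0 x)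
    - Fp wA f 0 y * Kp wA wB g h 1 x - Fp wA f 1 y * Kp wA wB g h 0 x
    - Gp wB g 0 x * Yp wA wB f h 1 y - Gp wB g 1 x * Yp wA wB f h 0 y
    - Fp wA f 1 y * Gp wB g 1 x * Hb wA wB h 1 + Fp wA f 0 y * Gp wB g 1 x * Hb wA wB h 1
    + Fp wA f 1 y * Gp wB g 0 x * Hb wA wB h 1 + Fp wA f 1 y * Gp wB g 1 x * Hb wA wB h 0

end Defs

section Atoms

variable {α β γ : Type} [Fintype α] [Fintype β] [Fintype γ]
  {wA : α → ℝ} {wB : β → ℝ} {wC : γ → ℝ}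
  {f : Fin 2 → γ → α → ℝ} {g : Fin 2 → γ → β → ℝ} {h : Fin 2 → α → β → ℝ}

omit [Fintype β] [Fintype γ] in
/-- `Fm` of the pair family at index `0` is the point atom at `x`. [this work] -/
@[simp] theorem Fm_fpair_zero (x y : γ) (z : Fin 2) : Fm wA (fpair f x y) 0 z = Fp wA f z x := by
  simp [Fm, fpair, Fp]
omit [Fintype β] [Fintype γ] in
/-- `Fm` of the pair family at index `1` is the point atom at `y`. [this work] -/
@[simp] theorem Fm_fpair_one (x y : γ) (z : Fin 2) : Fm wA (fpair f x y) 1 z = Fp wA f z y := by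
  simp [Fm, fpair, Fp]
omit [Fintype α] [Fintype γ] in
/-- `gm` of the pair family at index `0`. [this work] -/
@[simp] theorem gm_gpair_zero (x y : γ) (z : Fin 2) : gm wB (gpair g x y) 0 z = Gp wB g z x := by
  simp [gm, gpair, Gp]
omit [Fintype α] [Fintype γ] in
/-- `gm` of the pair family at index `1`. [this work] -/
@[simp] theorem gm_gpair_one (x y : γ) (z : Fin 2) : gm wB (gpair g x y) 1 z = Gp wB g z y := by
  simp [gm, gpair, Gp]
omit [Fintype γ] in
/-- `Ybar` of the pair family at index `0`. [this work] -/
@[simp] theorem Ybar_fpair_zero (x y : γ) (z : Fin 2) : Ybar wA wB (fpair f x y) h 0 z = Yp wA wB f h z x := by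
  simp [Ybar, Ysl, fpair, Yp]
omit [Fintype γ] in
/-- `Ybar` of the pair family at index `1`. [this work] -/
@[simp] theorem Ybar_fpair_one (x y : γ) (z : Fin 2) : Ybar wA wB (fpair f x y) h 1 z = Yp wA wB f h z y := by
  simp [Ybar, Ysl, fpair, Yp]
omit [Fintype γ] in
/-- Diagonal `Sgy 0 0` of the pair family is the joint atom at `x`. [this work] -/
@[simp] theorem Sgy_pair_zero (x y : γ) (z : Fin 2) :
    Sgy wA wB (fpair f x y) (gpair g x y) h 0 0 z = Jp wA wB f g h z x := by
  simp [Sgy, Ysl, fpair, gpair, Jp]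
omit [Fintype γ] in
/-- Diagonal `Sgy 1 1` of the pair family is the joint atom at `y`. [this work] -/
@[simp] theorem Sgy_pair_one (x y : γ) (z : Fin 2) :
    Sgy wA wB (fpair f x y) (gpair g x y) h 1 1 z = Jp wA wB f g h z y := by
  simp [Sgy, Ysl, fpair, gpair, Jp]
omit [Fintype γ] in
/-- `Sgh 0` of the pair family is `K` at `x`. [this work] -/
@[simp] theorem Sgh_gpair_zero (x y : γ) (z : Fin 2) : Sgh wA wB (gpair g x y) h 0 z = Kp wA wB g h z x := by
  simp [Sgh, Hsl, gpair, Kp]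
omit [Fintype γ] in
/-- `Sgh 1` of the pair family is `K` at `y`. [this work] -/
@[simp] theorem Sgh_gpair_one (x y : γ) (z : Fin 2) : Sgh wA wB (gpair g x y) h 1 z = Kp wA wB g h z y := by
  simp [Sgh, Hsl, gpair, Kp]

omit [Fintype γ] in
/-- **`CF(x,y) = A(x,y) + A(y,x)`**: the pair form (= `crossForm` of the pair family) is the symmetrisation of the point kernel. [this work] -/
theorem pairForm_eq_pairKer (x y : γ) :
    pairForm wA wB f g h x y = pairKer wA wB f g h x y + pairKer wA wB f g h y x := by
  unfold pairForm crossForm levelForm crossN pairKer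
  simp only [Fm_fpair_zero, Fm_fpair_one, gm_gpair_zero, gm_gpair_one, Ybar_fpair_zero, Ybar_fpair_one,
    Sgy_pair_zero, Sgy_pair_one, Sgh_gpair_zero, Sgh_gpair_one]
  ring

omit [Fintype γ] in
/-- The pair form is SYMMETRIC in the two block points. [this work] -/
theorem pairForm_symm (x y : γ) : pairForm wA wB f g h x y = pairForm wA wB f g h y x := by
  rw [pairForm_eq_pairKer, pairForm_eq_pairKer]; ring

/-! ### Level moments as block sums of point atoms -/

/-- Reindexing of a level expectation: `E^z φ = Σ_c wC(c) Σ_b wB(b) Σ_a wA(a) φ(a,b,(z,c))`. [this work] -/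
theorem exL_expand (z : Fin 2) (φ : α × β × (Fin 2 × γ) → ℝ) :
    exL wA wB wC z φ = ∑ c, wC c * ∑ b, wB b * ∑ a, wA a * φ (a, b, (z, c)) := by
  simp only [exL, ex, WL, Fintype.sum_prod_type]
  calc ∑ a, ∑ b, ∑ c, wA a * wB b * wC c * φ (a, b, (z, c))
      = ∑ a, ∑ c, ∑ b, wA a * wB b * wC c * φ (a, b, (z, c)) := Finset.sum_congr rfl fun a _ => Finset.sum_comm
    _ = ∑ c, ∑ a, ∑ b, wA a * wB b * wC c * φ (a, b, (z, c)) := Finset.sum_comm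
    _ = ∑ c, ∑ b, ∑ a, wA a * wB b * wC c * φ (a, b, (z, c)) := Finset.sum_congr rfl fun c _ => Finset.sum_comm
    _ = ∑ c, wC c * ∑ b, wB b * ∑ a, wA a * φ (a, b, (z, c)) := by
        simp only [Finset.mul_sum]
        exact Finset.sum_congr rfl fun c _ => Finset.sum_congr rfl fun b _ => Finset.sum_congr rfl fun a _ => by ring

/-- `E^z f = Σ_c wC(c) F_z(c)` (weight `wB` of mass one). [this work] -/
theorem exL_F1 (hB1 : ∑ b, wB b = 1) (z : Fin 2) : exL wA wB wC z (F1 f) = ∑ c, wC c * Fp wA f z c := by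
  rw [exL_expand]; refine Finset.sum_congr rfl fun c _ => ?_
  simp only [F1, Fp]; rw [← Finset.sum_mul, hB1, one_mul]

/-- `E^z g = Σ_c wC(c) G_z(c)` (weight `wA` of mass one). [this work] -/
theorem exL_F2 (hA1 : ∑ a, wA a = 1) (z : Fin 2) : exL wA wB wC z (F2 g) = ∑ c, wC c * Gp wB g z c := by
  rw [exL_expand]; refine Finset.sum_congr rfl fun c _ => ?_
  simp only [F2, Gp]; congr 1
  exact Finset.sum_congr rfl fun b _ => by rw [← Finset.sum_mul, hA1, one_mul]

/-- `E^z h = H̄_z` (weight `wC` of mass one). [this work] -/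
theorem exL_F3 (hC1 : ∑ c, wC c = 1) (z : Fin 2) : exL wA wB wC z (F3 h) = Hb wA wB h z := by
  rw [exL_expand]; simp only [F3, Hb, Hsl]; rw [← Finset.sum_mul, hC1, one_mul]

/-- `E^z(fgh) = Σ_c wC(c) J_z(c)`. [this work] -/
theorem exL_F123 (z : Fin 2) : exL wA wB wC z (F1 f * F2 g * F3 h) = ∑ c, wC c * Jp wA wB f g h z c := by
  rw [exL_expand]; refine Finset.sum_congr rfl fun c _ => ?_
  simp only [Pi.mul_apply, F1, F2, F3, Jp]; congr 1
  refine Finset.sum_congr rfl fun b _ => ?_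
  congr 1; rw [Finset.mul_sum]; exact Finset.sum_congr rfl fun a _ => by ring

/-- `E^z(gh) = Σ_c wC(c) K_z(c)`. [this work] -/
theorem exL_F23 (z : Fin 2) : exL wA wB wC z (F2 g * F3 h) = ∑ c, wC c * Kp wA wB g h z c := by
  rw [exL_expand]; refine Finset.sum_congr rfl fun c _ => ?_
  simp only [Pi.mul_apply, F2, F3, Kp]; congr 1
  refine Finset.sum_congr rfl fun b _ => ?_
  congr 1; rw [Finset.mul_sum]; exact Finset.sum_congr rfl fun a _ => by ring

/-- `E^z(fh) = Σ_c wC(c) Ȳ_z(c)`. [this work] -/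
theorem exL_F13 (z : Fin 2) : exL wA wB wC z (F1 f * F3 h) = ∑ c, wC c * Yp wA wB f h z c := by
  rw [exL_expand]; exact Finset.sum_congr rfl fun c _ => by simp only [Pi.mul_apply, F1, F3, Yp]

/-- `E^z(fg) = Σ_c wC(c) F_z(c)G_z(c)` (the private blocks are independent). [this work] -/
theorem exL_F12 (z : Fin 2) : exL wA wB wC z (F1 f * F2 g) = ∑ c, wC c * (Fp wA f z c * Gp wB g z c) := by
  rw [exL_expand]; refine Finset.sum_congr rfl fun c _ => ?_
  simp only [Pi.mul_apply, F1, F2, Fp, Gp]; congr 1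
  rw [Finset.mul_sum]; refine Finset.sum_congr rfl fun b _ => ?_
  rw [Finset.sum_mul, Finset.mul_sum]; exact Finset.sum_congr rfl fun a _ => by ring

/-! ### The pair decomposition -/

omit [Fintype α] [Fintype β] in
/-- Double block sum of a function of the first point only (weight of mass one). [this work] -/
theorem dsum_left (hC1 : ∑ c, wC c = 1) (u : γ → ℝ) : ∑ x, ∑ y, wC x * wC y * u x = ∑ x, wC x * u x := by
  refine Finset.sum_congr rfl fun x _ => ?_
  have e : ∑ y, wC x * wC y * u x = (wC x * u x) * ∑ y, wC y := by
    rw [Finset.mul_sum]; exact Finset.sum_congr rfl fun y _ => by ring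
  rw [e, hC1, mul_one]

omit [Fintype α] [Fintype β] in
/-- Double block sum of a product `u(x)·v(y)` factorises. [this work] -/
theorem dsum_prod (u v : γ → ℝ) :
    ∑ x, ∑ y, wC x * wC y * (u x * v y) = (∑ x, wC x * u x) * (∑ y, wC y * v y) := by
  rw [Finset.sum_mul_sum]
  exact Finset.sum_congr rfl fun x _ => Finset.sum_congr rfl fun y _ => by ring

/-- The double block sum of the point kernel, in closed form (weight `wC` of mass one). [this work] -/
theorem sum_pairKer (hC1 : ∑ c, wC c = 1) :
    ∑ x, ∑ y, wC x * wC y * pairKer wA wB f g h x y =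
      2 * (∑ c, wC c * Jp wA wB f g h 1 c) + 2 * (∑ c, wC c * Jp wA wB f g h 0 c)
        - Hb wA wB h 0 * (∑ c, wC c * (Fp wA f 1 c * Gp wB g 1 c)) - Hb wA wB h 1 * (∑ c, wC c * (Fp wA f 0 c * Gp wB g 0 c))
        - (∑ c, wC c * Fp wA f 0 c) * (∑ c, wC c * Kp wA wB g h 1 c)
        - (∑ c, wC c * Fp wA f 1 c) * (∑ c, wC c * Kp wA wB g h 0 c)
        - (∑ c, wC c * Gp wB g 0 c) * (∑ c, wC c * Yp wA wB f h 1 c)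
        - (∑ c, wC c * Gp wB g 1 c) * (∑ c, wC c * Yp wA wB f h 0 c)
        - (∑ c, wC c * Fp wA f 1 c) * (∑ c, wC c * Gp wB g 1 c) * Hb wA wB h 1
        + (∑ c, wC c * Fp wA f 0 c) * (∑ c, wC c * Gp wB g 1 c) * Hb wA wB h 1
        + (∑ c, wC c * Fp wA f 1 c) * (∑ c, wC c * Gp wB g 0 c) * Hb wA wB h 1
        + (∑ c, wC c * Fp wA f 1 c) * (∑ c, wC c * Gp wB g 1 c) * Hb wA wB h 0 := by
  -- split the summand into a function of `x` alone and eight products `u(x)·v(y)`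
  have e : ∀ x y, wC x * wC y * pairKer wA wB f g h x y =
      2 * (wC x * wC y * Jp wA wB f g h 1 x) + 2 * (wC x * wC y * Jp wA wB f g h 0 x)
      - Hb wA wB h 0 * (wC x * wC y * (Fp wA f 1 x * Gp wB g 1 x))
      - Hb wA wB h 1 * (wC x * wC y * (Fp wA f 0 x * Gp wB g 0 x))
      - wC x * wC y * (Kp wA wB g h 1 x * Fp wA f 0 y)
      - wC x * wC y * (Kp wA wB g h 0 x * Fp wA f 1 y)
      - wC x * wC y * (Gp wB g 0 x * Yp wA wB f h 1 y)
      - wC x * wC y * (Gp wB g 1 x * Yp wA wB f h 0 y)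
      - Hb wA wB h 1 * (wC x * wC y * (Gp wB g 1 x * Fp wA f 1 y))
      + Hb wA wB h 1 * (wC x * wC y * (Gp wB g 1 x * Fp wA f 0 y))
      + Hb wA wB h 1 * (wC x * wC y * (Gp wB g 0 x * Fp wA f 1 y))
      + Hb wA wB h 0 * (wC x * wC y * (Gp wB g 1 x * Fp wA f 1 y)) := by
    intro x y; unfold pairKer; ring
  simp only [e, Finset.sum_add_distrib, Finset.sum_sub_distrib, ← Finset.mul_sum, dsum_left hC1, dsum_prod]
  ring

/-- **THE PAIR DECOMPOSITION.**  For ANY finite block `γ` and weights of mass one,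
`2·q₁ = Σ_x Σ_y wC(x) wC(y) · CF(x,y)` with `CF` the pair form. [this work] -/
theorem two_mul_cornerQ1_eq_sum_pairForm (hA1 : ∑ a, wA a = 1) (hB1 : ∑ b, wB b = 1) (hC1 : ∑ c, wC c = 1) :
    2 * cornerQ1 wA wB wC f g h = ∑ x, ∑ y, wC x * wC y * pairForm wA wB f g h x y := by
  have hsplit : ∑ x, ∑ y, wC x * wC y * pairForm wA wB f g h x y =
      ∑ x, ∑ y, wC x * wC y * pairKer wA wB f g h x y + ∑ x, ∑ y, wC x * wC y * pairKer wA wB f g h y x := by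
    rw [← Finset.sum_add_distrib]
    refine Finset.sum_congr rfl fun x _ => ?_
    rw [← Finset.sum_add_distrib]
    exact Finset.sum_congr rfl fun y _ => by rw [pairForm_eq_pairKer]; ring
  have hswap : ∑ x, ∑ y, wC x * wC y * pairKer wA wB f g h y x = ∑ x, ∑ y, wC x * wC y * pairKer wA wB f g h x y := by
    rw [Finset.sum_comm]
    exact Finset.sum_congr rfl fun x _ => Finset.sum_congr rfl fun y _ => by ring
  rw [hsplit, hswap, sum_pairKer hC1]
  unfold cornerQ1 cornerMixed
  simp only [exL_F1 hB1, exL_F2 hA1, exL_F3 hC1, exL_F123, exL_F23, exL_F13, exL_F12]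
  ring

/-! ### Positivity -/

omit [Fintype γ] in
/-- **COMPARABLE PAIRS ARE NONNEGATIVE.**  For block points `x ≤ y` (sections monotone in `c`), the pair form `CF(x,y) ≥ 0`: this is
`SahiHubTwoLevel.crossForm_nonneg` (gen 29, `I3 ≥ 0`) for the two-point family. [this work] -/
theorem pairForm_nonneg_of_le [DistribLattice α] [DistribLattice β] [Preorder γ]
    (hA : IsFKGMeasure wA) (hB : IsFKGMeasure wB) {x y : γ} (hxy : x ≤ y)
    (hf0 : ∀ z c a, 0 ≤ f z c a) (hfa : ∀ z c, Monotone (f z c)) (hfc : ∀ z a, Monotone (fun c => f z c a))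
    (hfz : ∀ c a, f 0 c a ≤ f 1 c a)
    (hg0 : ∀ z c b, 0 ≤ g z c b) (hgb : ∀ z c, Monotone (g z c)) (hgc : ∀ z b, Monotone (fun c => g z c b))
    (hgz : ∀ c b, g 0 c b ≤ g 1 c b)
    (hh0 : ∀ z a b, 0 ≤ h z a b) (hha : ∀ z b, Monotone (fun a => h z a b)) (hhb : ∀ z a, Monotone (h z a))
    (hhz : ∀ a b, h 0 a b ≤ h 1 a b) :
    0 ≤ pairForm wA wB f g h x y := by
  unfold pairForm
  refine crossForm_nonneg hA hB ?_ ?_ ?_ ?_ ?_ ?_ ?_ ?_ hh0 hha hhb hhz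
  · intro i z a; fin_cases i <;> simp [fpair, hf0]
  · intro z a; simpa [fpair] using hfc z a hxy
  · intro i z a a' haa; fin_cases i <;> simp [fpair] <;> exact hfa z _ haa
  · intro i a; fin_cases i <;> simp [fpair, hfz]
  · intro j z b; fin_cases j <;> simp [gpair, hg0]
  · intro z b; simpa [gpair] using hgc z b hxy
  · intro j z b b' hbb; fin_cases j <;> simp [gpair] <;> exact hgb z _ hbb
  · intro j b; fin_cases j <;> simp [gpair, hgz]

/-- **`q₁ ≥ 0` AS SOON AS EVERY PAIR FORM IS NONNEGATIVE** (any finite block `γ`, weights nonnegative of mass one).  On a general block only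
the incomparable pairs are in question (`pairForm_nonneg_of_le`). [this work] -/
theorem cornerQ1_nonneg_of_pairForm (hA1 : ∑ a, wA a = 1) (hB1 : ∑ b, wB b = 1) (hC0 : ∀ c, 0 ≤ wC c) (hC1 : ∑ c, wC c = 1)
    (hpair : ∀ x y, 0 ≤ pairForm wA wB f g h x y) : 0 ≤ cornerQ1 wA wB wC f g h := by
  have h2 := two_mul_cornerQ1_eq_sum_pairForm (f := f) (g := g) (h := h) hA1 hB1 hC1
  have hs : 0 ≤ ∑ x, ∑ y, wC x * wC y * pairForm wA wB f g h x y :=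
    Finset.sum_nonneg fun x _ => Finset.sum_nonneg fun y _ => mul_nonneg (mul_nonneg (hC0 x) (hC0 y)) (hpair x y)
  linarith

/-- **Q ON CHAINS, corner `t = 1`**: for a TOTALLY ORDERED block `γ` with any probability weight, `q₁ ≥ 0`. [this work] -/
theorem cornerQ1_nonneg_chain [DistribLattice α] [DistribLattice β] [LinearOrder γ]
    (hA : IsFKGMeasure wA) (hB : IsFKGMeasure wB) (hC0 : ∀ c, 0 ≤ wC c) (hC1 : ∑ c, wC c = 1)
    (hf0 : ∀ z c a, 0 ≤ f z c a) (hfa : ∀ z c, Monotone (f z c)) (hfc : ∀ z a, Monotone (fun c => f z c a))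
    (hfz : ∀ c a, f 0 c a ≤ f 1 c a)
    (hg0 : ∀ z c b, 0 ≤ g z c b) (hgb : ∀ z c, Monotone (g z c)) (hgc : ∀ z b, Monotone (fun c => g z c b))
    (hgz : ∀ c b, g 0 c b ≤ g 1 c b)
    (hh0 : ∀ z a b, 0 ≤ h z a b) (hha : ∀ z b, Monotone (fun a => h z a b)) (hhb : ∀ z a, Monotone (h z a))
    (hhz : ∀ a b, h 0 a b ≤ h 1 a b) :
    0 ≤ cornerQ1 wA wB wC f g h := by
  refine cornerQ1_nonneg_of_pairForm hA.sum_eq_one hB.sum_eq_one hC0 hC1 fun x y => ?_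
  rcases le_total x y with hxy | hyx
  · exact pairForm_nonneg_of_le hA hB hxy hf0 hfa hfc hfz hg0 hgb hgc hgz hh0 hha hhb hhz
  · rw [pairForm_symm]
    exact pairForm_nonneg_of_le hA hB hyx hf0 hfa hfc hfz hg0 hgb hgc hgz hh0 hha hhb hhz

/-- `q₀ = q₁ + Δf·Δg·Δh` (`ΔX = E¹X − E⁰X`): the two corners differ by the product of the three hub increments (pure bookkeeping). [this work] -/
theorem cornerQ0_eq : cornerQ0 wA wB wC f g h = cornerQ1 wA wB wC f g h
    + (exL wA wB wC 1 (F1 f) - exL wA wB wC 0 (F1 f)) * (exL wA wB wC 1 (F2 g) - exL wA wB wC 0 (F2 g))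
      * (exL wA wB wC 1 (F3 h) - exL wA wB wC 0 (F3 h)) := by
  unfold cornerQ0 cornerQ1; ring

/-- `E¹f ≥ E⁰f` for sections increasing in the hub level (nonnegative weights, `wB` of mass one). [this work] -/
theorem exL_F1_sub_nonneg (hA0 : ∀ a, 0 ≤ wA a) (hB1 : ∑ b, wB b = 1) (hC0 : ∀ c, 0 ≤ wC c)
    (hfz : ∀ c a, f 0 c a ≤ f 1 c a) : 0 ≤ exL wA wB wC 1 (F1 f) - exL wA wB wC 0 (F1 f) := by
  rw [exL_F1 hB1, exL_F1 hB1, ← Finset.sum_sub_distrib]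
  refine Finset.sum_nonneg fun c _ => ?_
  rw [← mul_sub]
  refine mul_nonneg (hC0 c) ?_
  simp only [Fp]
  rw [← Finset.sum_sub_distrib]
  exact Finset.sum_nonneg fun a _ => by rw [← mul_sub]; exact mul_nonneg (hA0 a) (sub_nonneg.2 (hfz c a))

/-- `E¹g ≥ E⁰g` for sections increasing in the hub level. [this work] -/
theorem exL_F2_sub_nonneg (hA1 : ∑ a, wA a = 1) (hB0 : ∀ b, 0 ≤ wB b) (hC0 : ∀ c, 0 ≤ wC c)
    (hgz : ∀ c b, g 0 c b ≤ g 1 c b) : 0 ≤ exL wA wB wC 1 (F2 g) - exL wA wB wC 0 (F2 g) := by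
  rw [exL_F2 hA1, exL_F2 hA1, ← Finset.sum_sub_distrib]
  refine Finset.sum_nonneg fun c _ => ?_
  rw [← mul_sub]
  refine mul_nonneg (hC0 c) ?_
  simp only [Gp]
  rw [← Finset.sum_sub_distrib]
  exact Finset.sum_nonneg fun b _ => by rw [← mul_sub]; exact mul_nonneg (hB0 b) (sub_nonneg.2 (hgz c b))

/-- `E¹h ≥ E⁰h` for `h` increasing in the hub level (this is `SahiHubTwoLevel.Hb_sub_nonneg`). [this work] -/
theorem exL_F3_sub_nonneg (hA0 : ∀ a, 0 ≤ wA a) (hB0 : ∀ b, 0 ≤ wB b) (hC1 : ∑ c, wC c = 1)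
    (hhz : ∀ a b, h 0 a b ≤ h 1 a b) : 0 ≤ exL wA wB wC 1 (F3 h) - exL wA wB wC 0 (F3 h) := by
  rw [exL_F3 hC1, exL_F3 hC1]
  exact Hb_sub_nonneg hA0 hB0 hhz

/-- **Q ON CHAINS, corner `t = 0`**: `q₀ ≥ 0` on every totally ordered block (`q₀ = q₁ + Δf Δg Δh ≥ q₁`). [this work] -/
theorem cornerQ0_nonneg_chain [DistribLattice α] [DistribLattice β] [LinearOrder γ]
    (hA : IsFKGMeasure wA) (hB : IsFKGMeasure wB) (hC0 : ∀ c, 0 ≤ wC c) (hC1 : ∑ c, wC c = 1)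
    (hf0 : ∀ z c a, 0 ≤ f z c a) (hfa : ∀ z c, Monotone (f z c)) (hfc : ∀ z a, Monotone (fun c => f z c a))
    (hfz : ∀ c a, f 0 c a ≤ f 1 c a)
    (hg0 : ∀ z c b, 0 ≤ g z c b) (hgb : ∀ z c, Monotone (g z c)) (hgc : ∀ z b, Monotone (fun c => g z c b))
    (hgz : ∀ c b, g 0 c b ≤ g 1 c b)
    (hh0 : ∀ z a b, 0 ≤ h z a b) (hha : ∀ z b, Monotone (fun a => h z a b)) (hhb : ∀ z a, Monotone (h z a))
    (hhz : ∀ a b, h 0 a b ≤ h 1 a b) :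
    0 ≤ cornerQ0 wA wB wC f g h := by
  rw [cornerQ0_eq]
  have h1 := cornerQ1_nonneg_chain hA hB hC0 hC1 hf0 hfa hfc hfz hg0 hgb hgc hgz hh0 hha hhb hhz
  have hF := exL_F1_sub_nonneg (f := f) (wC := wC) hA.nonneg hB.sum_eq_one hC0 hfz
  have hG := exL_F2_sub_nonneg (g := g) (wC := wC) hA.sum_eq_one hB.nonneg hC0 hgz
  have hH := exL_F3_sub_nonneg (h := h) (wC := wC) hA.nonneg hB.nonneg hC1 hhz
  have := mul_nonneg (mul_nonneg hF hG) hH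
  linarith

/-- **THEOREM (T₁ WITH A TOTALLY ORDERED CO-SHARED BLOCK).**  Let `z ∈ Fin 2` be a hub coin with any weight `wZ ≥ 0`, `wZ 0 + wZ 1 = 1`,
let the co-shared block `γ` of the first two members be a finite CHAIN with any probability weight `wC`, and let `α, β` be finite
distributive lattices with FKG probability weights.  For `f(z,c,a), g(z,c,b), h(z,a,b)` nonnegative and monotone in every argument,
Sahi's `E₃(f,g,h) ≥ 0` — Kahn's `C₃` for every T₁ triple whose co-shared block is totally ordered (e.g. the first two members depend
on their common non-hub coordinates through a monotone chain statistic).  Extends `sahiE_three_nonneg_T1C1` (the two-point chain). [this work] -/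
theorem sahiE_three_nonneg_T1_chain [DistribLattice α] [DistribLattice β] [LinearOrder γ] {wZ : Fin 2 → ℝ}
    (hA : IsFKGMeasure wA) (hB : IsFKGMeasure wB) (hC0 : ∀ c, 0 ≤ wC c) (hC1 : ∑ c, wC c = 1)
    (hZ0 : 0 ≤ wZ 0) (hZ1 : 0 ≤ wZ 1) (hZ : wZ 0 + wZ 1 = 1)
    (hf0 : ∀ z c a, 0 ≤ f z c a) (hfa : ∀ z c, Monotone (f z c)) (hfc : ∀ z a, Monotone (fun c => f z c a))
    (hfz : ∀ c a, f 0 c a ≤ f 1 c a)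
    (hg0 : ∀ z c b, 0 ≤ g z c b) (hgb : ∀ z c, Monotone (g z c)) (hgc : ∀ z b, Monotone (fun c => g z c b))
    (hgz : ∀ c b, g 0 c b ≤ g 1 c b)
    (hh0 : ∀ z a b, 0 ≤ h z a b) (hha : ∀ z b, Monotone (fun a => h z a b)) (hhb : ∀ z a, Monotone (h z a))
    (hhz : ∀ a b, h 0 a b ≤ h 1 a b) :
    0 ≤ sahiE (W wA wB wC wZ) 3 ![F1 f, F2 g, F3 h] :=
  sahiE_three_nonneg_T1_of_corner hA hB (isFKGMeasure_of_linearOrder hC0 hC1) hZ0 hZ1 hZ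
    hf0 hfa hfc hg0 hgb hgc hh0 hha hhb
    (cornerQ0_nonneg_chain hA hB hC0 hC1 hf0 hfa hfc hfz hg0 hgb hgc hgz hh0 hha hhb hhz)
    (cornerQ1_nonneg_chain hA hB hC0 hC1 hf0 hfa hfc hfz hg0 hgb hgc hgz hh0 hha hhb hhz)

end Atoms

end SahiHubCornerChain

end Summit.CriticalPhenomena.PercolationContinuityZ3.Theorems
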